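import Literature.Computability.Complexity.RandomKSatPairPolyBasic
import Literature.Probability.LatticeModels.BinomialEntropy
import Mathlib.Analysis.Calculus.Deriv.MeanValue
import Mathlib.Analysis.SpecialFunctions.Log.Deriv
import Mathlib.Algebra.Order.Ring.Pow
import HarnessLib

/-!
# The second moment near overlap `1`: the truncated weight (Achlioptas–Peres, Lemma 9)

Continuation of `RandomKSatPairPolyBasic.lean` (AP2004 = D. Achlioptas, Y. Peres, J. Amer. Math.
Soc. 17 (2004); arXiv:cs/0305009), §9 (proof of Lemma 9, pp. 17–21): for `α ∈ (9/10, 1]` the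
second moment is controlled with the SMALLER parameter `ε₁ = ε₀/2` (`λ₁ = 1 - ε₁`), and the
inequality to prove, AP (56), is `(f(α,ε₁)/f(1/2,ε₀))^r < 2 α^α (1-α)^{1-α}`, i.e.
`r log W(α) < log 2 - h(α) = spinRate(2α-1)` with `W(α) = ρ^k F_{λ₁}(α)/F_{λ₀}(1/2)`,
`ρ = λ₀/λ₁` (`ρ^k` is the truncation gain `(λ₀/λ₁)^{km}` per clause, `RandomKSatWeights.lean`,
`balanced_pair_le`). This file proves AP's chain (57)–(67) reducing (56) to the explicit
sufficient condition `r ≤ S(α) ((1-ε₁)^k (B - αC) - E_k)`, `B = 2^k(k+1) - 3k - 1/2`,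
`C = k(2^k - 7/2)`, with an explicit error `E_k → 0` (AP: `2 (2/3)^k`); the minimisation of
`φ(α) = S(α)(B - αC)` (AP (68)–(83)) is `RandomKSatPhiLowerBound.lean`.

## Results (all proved)

* `log_one_add_le_cubic`, `recip_cubic_ge`, `mul_log_one_add_le_of_le` — AP (57): for
  `0 < w ≤ 1`, `r log(1+w) ≤ S` as soon as `r ≤ S (1/w + 1/2 - w/3)`;
* `upsilon3_sub_le` — AP (63): with `Υ₃(ε) = ((2-ε)^k-1)²/(1-ε)^k`, `ε₀(2-ε₀)^{k-1} = 1`: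
  `Υ₃(ε₀/2) - Υ₃(ε₀) ≤ k (2-ε₀)^k ε₀ / (8 (1-ε₀)^{k+1})` (derivative `-Υ₃' = k((2-ε)^k-1)
  (1-ε)^{-k-1} Υ₁(ε)`, `Υ₁ ≤ 1 - ε/ε₀` (61), and the antiderivative `K(ε - ε²/(2ε₀))`);
* `coeff_one_sq_le`, `abs_coeff_le_one` — the coefficient bounds for `λ₁`: `c₁(λ₁)² ≤ 1/4`,
  `|c_j(λ₁)| ≤ 1` (`j ≥ 2`), where `c_j = (1+λ)^{k-j}(1-λ)^j - 1`;
* power estimates (`one_div_pow_le_one_add`, `one_sub_pow_mul_le_one`,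
  `one_add_le_inv_pow_sub` = AP p. 19 "`1/(α^k - q) ≥ 1 + k(1-α) + q`", `one_add_pow_le_one_div`),
  `f_half_ge` (AP (58)), `T2_sub_le` (AP (60)), `fdiff_le` (AP (59), (64)–(65)),
  `inv_w_lower` (AP (66)–(67) and the identity `(2^k-2)(1 + k(1-α) + q) = B - αC - 1/2 + O(k/2^k)`);
* `optionB_of_le` — **the reduction of AP (56) to the sufficient condition**: for `k ≥ 7`,
  the balancing `ε₀` with `2/2^k ≤ ε₀ ≤ 2/2^k + 8k/4^k`, `α ∈ [9/10, 1]`: if `W(α) > 1` and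
  `0 ≤ r ≤ S((1-ε₁)^k(B - αC) - E_k)` (`S ≥ 0`) then `r log W(α) ≤ S`; here
  `E_k = (k+3)/2^k + 32k²(50/81)^k + 32k(5/9)^k` (an explicit null sequence dominating the
  dropped terms; AP: `2(2/3)^k`).
-/

noncomputable section

namespace Literature.Computability.Complexity

open Set Real Literature.Probability.LatticeModels

namespace RandomKSat

/-! ### AP (57): `r log(1+w) ≤ S` from `r ≤ S(1/w + 1/2 - w/3)` -/

/-- `log(1+w) ≤ w - w²/2 + w³/3` for `w ≥ 0` (the derivative of the difference is `w³/(1+w) ≥ 0`).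
[folklore] -/
theorem log_one_add_le_cubic {w : ℝ} (hw : 0 ≤ w) :
    Real.log (1 + w) ≤ w - w ^ 2 / 2 + w ^ 3 / 3 := by
  -- `d(t) = t - t²/2 + t³/3 - log(1+t)` is monotone on `[0, ∞)`
  set d : ℝ → ℝ := fun t => t - t ^ 2 / 2 + t ^ 3 / 3 - Real.log (1 + t) with hd
  have hderiv : ∀ t, 0 ≤ t → HasDerivAt d (t ^ 3 / (1 + t)) t := by
    intro t ht
    have h1 : HasDerivAt (fun t : ℝ => t - t ^ 2 / 2 + t ^ 3 / 3) (1 - t + t ^ 2) t := by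
      have := (((hasDerivAt_id' t).fun_sub (((hasDerivAt_id' t).fun_pow 2).div_const 2)).fun_add
        (((hasDerivAt_id' t).fun_pow 3).div_const 3))
      refine this.congr_deriv ?_
      push_cast; ring
    have h2 : HasDerivAt (fun t : ℝ => Real.log (1 + t)) (1 / (1 + t)) t :=
      ((hasDerivAt_id' t).const_add 1).log (by linarith)
    refine (h1.fun_sub h2).congr_deriv ?_
    field_simp
    ring
  have hmono : MonotoneOn d (Ici 0) := by
    apply monotoneOn_of_deriv_nonneg (convex_Ici 0)
    · intro t ht
      exact (hderiv t ht).continuousAt.continuousWithinAt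
    · rw [interior_Ici]; intro t ht
      exact (hderiv t (le_of_lt ht)).differentiableAt.differentiableWithinAt
    · rw [interior_Ici]; intro t ht
      rw [(hderiv t (le_of_lt ht)).deriv]
      have : (0 : ℝ) < t := ht
      positivity
  have h0 : d 0 = 0 := by simp [hd]
  have := hmono (self_mem_Ici) hw hw
  rw [h0] at this
  simp only [hd] at this
  linarith

/-- `(1/w + 1/2 - w/3)(w - w²/2 + w³/3) = 1 - w²(w/3 - 1/2)² ≤ 1` for `w > 0`. [folklore] -/
theorem recip_cubic_ge {w : ℝ} (hw : 0 < w) :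
    (1 / w + 1 / 2 - w / 3) * (w - w ^ 2 / 2 + w ^ 3 / 3) ≤ 1 := by
  have e : (1 / w + 1 / 2 - w / 3) * (w - w ^ 2 / 2 + w ^ 3 / 3) =
      1 - w ^ 2 * (w / 3 - 1 / 2) ^ 2 := by
    field_simp
    ring
  rw [e]
  nlinarith [sq_nonneg (w * (w / 3 - 1 / 2))]

/-- **AP (57)**: for `0 < w ≤ 1`, `S ≥ 0` and `0 ≤ r ≤ S (1/w + 1/2 - w/3)` one has
`r log(1+w) ≤ S` (AP use `1/log(1+w) ≥ 1/w + 1/2 - w/12`; the cubic version suffices).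
[cite: AchlioptasPeres2004, eq. (57) p. 17] -/
theorem mul_log_one_add_le_of_le {w S r : ℝ} (hw0 : 0 < w) (hw1 : w ≤ 1) (hS : 0 ≤ S)
    (hr0 : 0 ≤ r) (hr : r ≤ S * (1 / w + 1 / 2 - w / 3)) :
    r * Real.log (1 + w) ≤ S := by
  have hℓpos : 0 < w - w ^ 2 / 2 + w ^ 3 / 3 := by nlinarith
  have hlog := log_one_add_le_cubic hw0.le
  have hrec := recip_cubic_ge hw0
  have hA : 0 ≤ 1 / w + 1 / 2 - w / 3 := by
    have : 0 < 1 / w := by positivity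
    have h1w : 1 ≤ 1 / w := by rw [le_div_iff₀ hw0]; linarith
    linarith
  calc r * Real.log (1 + w) ≤ r * (w - w ^ 2 / 2 + w ^ 3 / 3) :=
        mul_le_mul_of_nonneg_left hlog hr0
    _ ≤ S * (1 / w + 1 / 2 - w / 3) * (w - w ^ 2 / 2 + w ^ 3 / 3) :=
        mul_le_mul_of_nonneg_right hr hℓpos.le
    _ = S * ((1 / w + 1 / 2 - w / 3) * (w - w ^ 2 / 2 + w ^ 3 / 3)) := by ring
    _ ≤ S * 1 := mul_le_mul_of_nonneg_left hrec hS
    _ = S := mul_one S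

/-! ### AP (61)–(63): the function `Υ₃(ε) = ((2-ε)^k - 1)²/(1-ε)^k` between `ε₀/2` and `ε₀` -/

/-- **AP (61)**: for `0 ≤ ε ≤ ε₀` with `ε₀ (2-ε₀)^{k-1} = 1`,
`Υ₁(ε) = 1 - (2-ε)^{k-1} ε ≤ 1 - ε/ε₀`. [cite: AchlioptasPeres2004, eq. (61) p. 18] -/
theorem upsilon1_le {k : ℕ} {ε₀ ε : ℝ} (hε₀ : 0 < ε₀) (hbal : ε₀ * (2 - ε₀) ^ (k - 1) = 1)
    (hε : ε ≤ ε₀) (hε2 : ε₀ ≤ 2) (h0 : 0 ≤ ε) :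
    1 - (2 - ε) ^ (k - 1) * ε ≤ 1 - ε / ε₀ := by
  have hpow : (2 - ε₀) ^ (k - 1) ≤ (2 - ε) ^ (k - 1) :=
    pow_le_pow_left₀ (by linarith) (by linarith) _
  have hinv : (2 - ε₀) ^ (k - 1) = 1 / ε₀ := by
    field_simp; linarith [hbal, mul_comm ε₀ ((2 - ε₀) ^ (k - 1))]
  have : ε / ε₀ ≤ (2 - ε) ^ (k - 1) * ε := by
    calc ε / ε₀ = (1 / ε₀) * ε := by ring
      _ ≤ (2 - ε) ^ (k - 1) * ε := by
          rw [← hinv]; exact mul_le_mul_of_nonneg_right hpow h0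
  linarith

/-- **AP (63)** (the antiderivative form of "integrate `-Υ₃' ≤ K(1 - ε/ε₀)`"): for `k ≥ 1`,
`0 < ε₀ < 1` with `ε₀(2-ε₀)^{k-1} = 1` and `ε₁ = ε₀/2`,
`Υ₃(ε₁) - Υ₃(ε₀) ≤ K ε₀/8`, `K = k (2-ε₀)^k/(1-ε₀)^{k+1}`, where
`Υ₃(ε) = ((2-ε)^k - 1)²/(1-ε)^k`. [cite: AchlioptasPeres2004, eq. (63) p. 18] -/
theorem upsilon3_sub_le {k : ℕ} (hk : 1 ≤ k) {ε₀ : ℝ} (hε₀ : 0 < ε₀) (hε₀1 : ε₀ < 1)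
    (hbal : ε₀ * (2 - ε₀) ^ (k - 1) = 1) :
    ((2 - ε₀ / 2) ^ k - 1) ^ 2 / (1 - ε₀ / 2) ^ k - ((2 - ε₀) ^ k - 1) ^ 2 / (1 - ε₀) ^ k ≤
      k * (2 - ε₀) ^ k / (1 - ε₀) ^ (k + 1) * (ε₀ / 8) := by
  obtain ⟨m, rfl⟩ : ∃ m, k = m + 1 := ⟨k - 1, by omega⟩
  simp only [Nat.add_sub_cancel] at hbal ⊢
  set K : ℝ := (m + 1 : ℕ) * (2 - ε₀) ^ (m + 1) / (1 - ε₀) ^ (m + 1 + 1) with hK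
  set Y : ℝ → ℝ := fun e => ((2 - e) ^ (m + 1) - 1) ^ 2 / (1 - e) ^ (m + 1) with hY
  -- derivative of `Υ₃`
  set Y' : ℝ → ℝ := fun e => -((m + 1 : ℕ) * ((2 - e) ^ (m + 1) - 1) * (1 - (2 - e) ^ m * e) /
    (1 - e) ^ (m + 1 + 1)) with hY'
  have hYd : ∀ e, e < 1 → HasDerivAt Y (Y' e) e := by
    intro e he
    have h1e : (1 : ℝ) - e ≠ 0 := by linarith
    have hnum : HasDerivAt (fun e : ℝ => ((2 - e) ^ (m + 1) - 1) ^ 2)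
        (2 * ((2 - e) ^ (m + 1) - 1) * (-((m + 1 : ℕ) * (2 - e) ^ m))) e := by
      have h := ((((hasDerivAt_id' e).const_sub 2).fun_pow (m + 1)).sub_const 1).fun_pow 2
      refine h.congr_deriv ?_
      simp only [Nat.add_sub_cancel]
      push_cast; ring
    have hden : HasDerivAt (fun e : ℝ => (1 - e) ^ (m + 1)) (-((m + 1 : ℕ) * (1 - e) ^ m)) e := by
      have h := ((hasDerivAt_id' e).const_sub 1).fun_pow (m + 1)
      refine h.congr_deriv ?_
      simp only [Nat.add_sub_cancel]
      ring
    have h := hnum.div hden (pow_ne_zero (m + 1) h1e)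
    refine h.congr_deriv ?_
    simp only [hY']
    field_simp
    ring
  -- the bound `-Υ₃'(ε) ≤ K (1 - ε/ε₀)` on `[ε₁, ε₀]`
  have hbound : ∀ e ∈ Icc (ε₀ / 2) ε₀, -Y' e ≤ K * (1 - e / ε₀) := by
    intro e he
    have he0 : 0 ≤ e := by linarith [he.1]
    have he1 : e < 1 := by linarith [he.2]
    have hU1 : 1 - (2 - e) ^ m * e ≤ 1 - e / ε₀ := by
      have := upsilon1_le (k := m + 1) hε₀ (by simpa using hbal) he.2 (by linarith) he0
      simpa using this
    have hU1' : 0 ≤ 1 - e / ε₀ := by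
      rw [sub_nonneg, div_le_one hε₀]; exact he.2
    simp only [hY', neg_neg]
    -- `((2-e)^k - 1)/(1-e)^{k+1} ≤ (2-ε₀)^k/(1-ε₀)^{k+1}` (`(2-x)/(1-x)` and `1/(1-x)` increase)
    have hA : 0 ≤ (2 - e) ^ (m + 1) - 1 := by
      have : (1 : ℝ) ≤ (2 - e) ^ (m + 1) := one_le_pow₀ (by linarith)
      linarith
    have hfrac : ((2 - e) ^ (m + 1) - 1) / (1 - e) ^ (m + 1 + 1) ≤
        (2 - ε₀) ^ (m + 1) / (1 - ε₀) ^ (m + 1 + 1) := by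
      have h1 : ((2 - e) ^ (m + 1) - 1) / (1 - e) ^ (m + 1 + 1) ≤
          (2 - e) ^ (m + 1) / (1 - e) ^ (m + 1 + 1) :=
        div_le_div_of_nonneg_right (by linarith) (pow_nonneg (by linarith) _)
      have hq : (2 - e) / (1 - e) ≤ (2 - ε₀) / (1 - ε₀) := by
        rw [div_le_div_iff₀ (by linarith) (by linarith)]; nlinarith [he.2]
      have hq0 : 0 ≤ (2 - e) / (1 - e) := div_nonneg (by linarith) (by linarith)
      have hr : 1 / (1 - e) ≤ 1 / (1 - ε₀) :=
        one_div_le_one_div_of_le (by linarith) (by linarith [he.2])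
      have e1 : (2 - e) ^ (m + 1) / (1 - e) ^ (m + 1 + 1) = ((2 - e) / (1 - e)) ^ (m + 1) * (1 / (1 - e)) := by
        rw [div_pow, pow_succ (1 - e) (m + 1)]; field_simp
      have e2 : (2 - ε₀) ^ (m + 1) / (1 - ε₀) ^ (m + 1 + 1) =
          ((2 - ε₀) / (1 - ε₀)) ^ (m + 1) * (1 / (1 - ε₀)) := by
        rw [div_pow, pow_succ (1 - ε₀) (m + 1)]; field_simp
      have h2 : (2 - e) ^ (m + 1) / (1 - e) ^ (m + 1 + 1) ≤ (2 - ε₀) ^ (m + 1) / (1 - ε₀) ^ (m + 1 + 1) := by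
        rw [e1, e2]
        apply mul_le_mul (pow_le_pow_left₀ hq0 hq _) hr (by positivity [he1])
          (pow_nonneg (div_nonneg (by linarith) (by linarith)) _)
      exact h1.trans h2
    have hkA : 0 ≤ ((m + 1 : ℕ) : ℝ) * (((2 - e) ^ (m + 1) - 1) / (1 - e) ^ (m + 1 + 1)) :=
      mul_nonneg (Nat.cast_nonneg _) (div_nonneg hA (pow_nonneg (by linarith) _))
    have hkA' : ((m + 1 : ℕ) : ℝ) * (((2 - e) ^ (m + 1) - 1) / (1 - e) ^ (m + 1 + 1)) ≤
        ((m + 1 : ℕ) : ℝ) * ((2 - ε₀) ^ (m + 1) / (1 - ε₀) ^ (m + 1 + 1)) :=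
      mul_le_mul_of_nonneg_left hfrac (Nat.cast_nonneg _)
    have hK0 : 0 ≤ ((m + 1 : ℕ) : ℝ) * ((2 - ε₀) ^ (m + 1) / (1 - ε₀) ^ (m + 1 + 1)) := by
      apply mul_nonneg (Nat.cast_nonneg _)
      exact div_nonneg (pow_nonneg (by linarith) _) (pow_nonneg (by linarith) _)
    have hKe : K = ((m + 1 : ℕ) : ℝ) * ((2 - ε₀) ^ (m + 1) / (1 - ε₀) ^ (m + 1 + 1)) := by
      rw [hK]; ring
    rw [show ((m + 1 : ℕ) : ℝ) * ((2 - e) ^ (m + 1) - 1) * (1 - (2 - e) ^ m * e) / (1 - e) ^ (m + 1 + 1) =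
      ((m + 1 : ℕ) : ℝ) * (((2 - e) ^ (m + 1) - 1) / (1 - e) ^ (m + 1 + 1)) * (1 - (2 - e) ^ m * e)
      by ring, hKe]
    by_cases hU : 0 ≤ 1 - (2 - e) ^ m * e
    · exact mul_le_mul hkA' hU1 hU hK0
    · have h1 : ((m + 1 : ℕ) : ℝ) * (((2 - e) ^ (m + 1) - 1) / (1 - e) ^ (m + 1 + 1)) *
          (1 - (2 - e) ^ m * e) ≤ 0 :=
        mul_nonpos_of_nonneg_of_nonpos hkA (le_of_lt (not_le.mp hU))
      have h2 : 0 ≤ ((m + 1 : ℕ) : ℝ) * ((2 - ε₀) ^ (m + 1) / (1 - ε₀) ^ (m + 1 + 1)) * (1 - e / ε₀) :=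
        mul_nonneg hK0 hU1'
      linarith
  -- antiderivative trick: `Q(e) = Y e + K (e - e²/(2ε₀))` is monotone on `[ε₁, ε₀]`
  set Q : ℝ → ℝ := fun e => Y e + K * (e - e ^ 2 / (2 * ε₀)) with hQ
  have hQd : ∀ e, e < 1 → HasDerivAt Q (Y' e + K * (1 - e / ε₀)) e := by
    intro e he
    have h2 : HasDerivAt (fun e : ℝ => K * (e - e ^ 2 / (2 * ε₀))) (K * (1 - e / ε₀)) e := by
      have := ((hasDerivAt_id' e).fun_sub (((hasDerivAt_id' e).fun_pow 2).div_const (2 * ε₀))).const_mul K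
      refine this.congr_deriv ?_
      field_simp; push_cast; ring
    exact (hYd e he).fun_add h2
  have hmono : MonotoneOn Q (Icc (ε₀ / 2) ε₀) := by
    apply monotoneOn_of_deriv_nonneg (convex_Icc _ _)
    · intro e he
      exact (hQd e (by linarith [he.2])).continuousAt.continuousWithinAt
    · rw [interior_Icc]; intro e he
      exact (hQd e (by linarith [he.2])).differentiableAt.differentiableWithinAt
    · rw [interior_Icc]; intro e he
      rw [(hQd e (by linarith [he.2])).deriv]
      have := hbound e ⟨he.1.le, he.2.le⟩
      linarith
  have hle := hmono ⟨le_rfl, by linarith⟩ ⟨by linarith, le_rfl⟩ (by linarith : ε₀ / 2 ≤ ε₀)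
  simp only [hQ, hY] at hle
  have e8 : K * (ε₀ - ε₀ ^ 2 / (2 * ε₀)) - K * (ε₀ / 2 - (ε₀ / 2) ^ 2 / (2 * ε₀)) = K * (ε₀ / 8) := by
    field_simp; ring
  rw [hK] at e8 hle
  linarith [e8]

/-! ### The coefficients `c_j(λ₁)` for `ε₁ = ε₀/2` -/

/-- `1/2 ≤ (2-ε₁)^{k-1} ε₁ ≤ 3/4` for `ε₁ = ε₀/2`, `ε₀(2-ε₀)^{k-1} = 1`, provided
`((2-ε₁)/(2-ε₀))^{k-1} ≤ 3/2` (true once `k ε₀ ≤ 1/2`). Hence `c₁(λ₁)² ≤ 1/4`.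
[cite: AchlioptasPeres2004, eq. (61)–(62) p. 18] -/
theorem coeff_one_sq_le {k : ℕ} {ε₀ : ℝ} (hε₀ : 0 < ε₀) (hε₀2 : ε₀ ≤ 1)
    (hbal : ε₀ * (2 - ε₀) ^ (k - 1) = 1)
    (hgrow : ((2 - ε₀ / 2) / (2 - ε₀)) ^ (k - 1) ≤ 3 / 2) :
    1 / 2 ≤ (2 - ε₀ / 2) ^ (k - 1) * (ε₀ / 2) ∧ (2 - ε₀ / 2) ^ (k - 1) * (ε₀ / 2) ≤ 3 / 4 ∧
      ((2 - ε₀ / 2) ^ (k - 1) * (ε₀ / 2) - 1) ^ 2 ≤ 1 / 4 := by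
  have hb : (2 - ε₀) ^ (k - 1) * ε₀ = 1 := by rw [mul_comm]; exact hbal
  have hpow : (2 - ε₀) ^ (k - 1) ≤ (2 - ε₀ / 2) ^ (k - 1) :=
    pow_le_pow_left₀ (by linarith) (by linarith) _
  have hlow : 1 / 2 ≤ (2 - ε₀ / 2) ^ (k - 1) * (ε₀ / 2) := by
    have := mul_le_mul_of_nonneg_right hpow (by linarith : 0 ≤ ε₀ / 2)
    calc (1 : ℝ) / 2 = (2 - ε₀) ^ (k - 1) * ε₀ / 2 := by rw [hb]
      _ = (2 - ε₀) ^ (k - 1) * (ε₀ / 2) := by ring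
      _ ≤ _ := this
  have hup : (2 - ε₀ / 2) ^ (k - 1) * (ε₀ / 2) ≤ 3 / 4 := by
    have h2 : (0 : ℝ) < (2 - ε₀) ^ (k - 1) := pow_pos (by linarith) _
    have e : (2 - ε₀ / 2) ^ (k - 1) = ((2 - ε₀ / 2) / (2 - ε₀)) ^ (k - 1) * (2 - ε₀) ^ (k - 1) := by
      rw [← mul_pow, div_mul_cancel₀ _ (by linarith : (2 : ℝ) - ε₀ ≠ 0)]
    rw [e, mul_assoc]
    calc ((2 - ε₀ / 2) / (2 - ε₀)) ^ (k - 1) * ((2 - ε₀) ^ (k - 1) * (ε₀ / 2))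
        = ((2 - ε₀ / 2) / (2 - ε₀)) ^ (k - 1) * (1 / 2) := by
          congr 1
          calc (2 - ε₀) ^ (k - 1) * (ε₀ / 2) = (2 - ε₀) ^ (k - 1) * ε₀ / 2 := by ring
            _ = 1 / 2 := by rw [hb]
      _ ≤ 3 / 2 * (1 / 2) := mul_le_mul_of_nonneg_right hgrow (by norm_num)
      _ = 3 / 4 := by norm_num
  refine ⟨hlow, hup, ?_⟩
  nlinarith

/-- `|c_j(λ₁)| ≤ 1` for `2 ≤ j ≤ k`: `0 ≤ (2-ε₁)^{k-j} ε₁^j ≤ (2-ε₁)^{k-1}ε₁ · ε₁^{j-1} ≤ 1`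
(for `ε₁ ≤ 1`, `2 - ε₁ ≥ 1`). [cite: AchlioptasPeres2004, text before (37) p. 13 and (59) p. 18] -/
theorem abs_coeff_le_one {k j : ℕ} (hj : 2 ≤ j) (hjk : j ≤ k) {ε₁ : ℝ} (h0 : 0 ≤ ε₁) (h1 : ε₁ ≤ 1)
    (hmain : (2 - ε₁) ^ (k - 1) * ε₁ ≤ 1) :
    |(2 - ε₁) ^ (k - j) * ε₁ ^ j - 1| ≤ 1 := by
  have hA : 0 ≤ (2 - ε₁) ^ (k - j) * ε₁ ^ j :=
    mul_nonneg (pow_nonneg (by linarith) _) (pow_nonneg h0 _)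
  have hB : (2 - ε₁) ^ (k - j) * ε₁ ^ j ≤ 1 := by
    have h2 : (2 - ε₁) ^ (k - j) ≤ (2 - ε₁) ^ (k - 1) :=
      pow_le_pow_right₀ (by linarith) (by omega)
    have h3 : ε₁ ^ j ≤ ε₁ := by
      calc ε₁ ^ j ≤ ε₁ ^ 1 := pow_le_pow_of_le_one h0 h1 (by omega)
        _ = ε₁ := pow_one ε₁
    calc (2 - ε₁) ^ (k - j) * ε₁ ^ j ≤ (2 - ε₁) ^ (k - 1) * ε₁ :=
          mul_le_mul h2 h3 (pow_nonneg h0 _) (pow_nonneg (by linarith) _)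
      _ ≤ 1 := hmain
  rw [abs_le]; constructor <;> linarith

/-! ### Elementary power estimates -/

/-- Inverse Bernoulli: for `t ≥ 0` with `2 n t ≤ 1`, `1/(1-t)^n ≤ 1 + 2 n t`. [folklore] -/
theorem one_div_pow_le_one_add {t : ℝ} {n : ℕ} (ht : 0 ≤ t) (hnt : 2 * n * t ≤ 1) :
    1 / (1 - t) ^ n ≤ 1 + 2 * n * t := by
  rcases Nat.eq_zero_or_pos n with rfl | hn
  · simp
  have hn1 : (1 : ℝ) ≤ n := by exact_mod_cast hn
  have ht2 : t ≤ 1 / 2 := by nlinarith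
  have hbern : 1 - n * t ≤ (1 - t) ^ n := by
    have h := one_add_mul_le_pow (show (-2 : ℝ) ≤ -t by linarith) n
    have e1 : (1 : ℝ) + -t = 1 - t := by ring
    have e2 : (1 : ℝ) + n * -t = 1 - n * t := by ring
    rw [e1, e2] at h; exact h
  have hpos : 0 < 1 - n * t := by nlinarith
  calc 1 / (1 - t) ^ n ≤ 1 / (1 - n * t) := one_div_le_one_div_of_le hpos hbern
    _ ≤ 1 + 2 * n * t := by
        rw [div_le_iff₀ hpos]
        nlinarith [mul_nonneg (Nat.cast_nonneg n) ht]

/-- `(1-y)^k (1 + k y) ≤ 1` for `0 ≤ y ≤ 1`, i.e. `α^k ≤ 1/(1 + k(1-α))`. [folklore] -/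
theorem one_sub_pow_mul_le_one {y : ℝ} (h0 : 0 ≤ y) (h1 : y ≤ 1) (k : ℕ) :
    (1 - y) ^ k * (1 + k * y) ≤ 1 := by
  induction k with
  | zero => simp
  | succ n ih =>
    have hp : 0 ≤ (1 - y) ^ n := pow_nonneg (by linarith) n
    push_cast
    have e : (1 - y) ^ (n + 1) * (1 + (n + 1) * y) =
        (1 - y) ^ n * (1 + n * y) - y * (1 - y) ^ n * ((n + 1) * y) := by ring
    rw [e]
    have : 0 ≤ y * (1 - y) ^ n * ((n + 1) * y) := by positivity
    linarith

/-- **AP p. 19**: for `0 ≤ q < α^k` (`0 < α ≤ 1`), `1/(α^k - q) ≥ 1 + k(1-α) + q`.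
[cite: AchlioptasPeres2004, §9 p. 19 ("Recall now that for any 0 < α < 1 and 0 ≤ q < α^k …")] -/
theorem one_add_le_inv_pow_sub {α q : ℝ} {k : ℕ} (hα0 : 0 ≤ α) (hα1 : α ≤ 1) (hq0 : 0 ≤ q)
    (hq : q < α ^ k) : 1 + k * (1 - α) + q ≤ 1 / (α ^ k - q) := by
  have hy := one_sub_pow_mul_le_one (y := 1 - α) (by linarith) (by linarith) k
  rw [show (1 : ℝ) - (1 - α) = α by ring] at hy
  have ht : 0 < α ^ k - q := by linarith
  rw [le_div_iff₀ ht]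
  -- `(1 + ky + q)(α^k - q) ≤ α^k (1 + ky) + q α^k - q(1+ky) - q² ≤ 1`
  have hαk : α ^ k ≤ 1 := pow_le_one₀ hα0 hα1
  have hky : 0 ≤ (k : ℝ) * (1 - α) := by positivity
  nlinarith [mul_nonneg hq0 hky, sq_nonneg q, mul_nonneg hq0 (sub_nonneg.mpr hαk)]

/-- `(1+x)^n ≤ 1/(1 - n x)` for `0 ≤ x`, `n x < 1` (from `(1-x²)^n ≤ 1` and Bernoulli). [folklore] -/
theorem one_add_pow_le_one_div {x : ℝ} {n : ℕ} (hx : 0 ≤ x) (hx1 : x ≤ 1) (hnx : n * x < 1) :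
    (1 + x) ^ n ≤ 1 / (1 - n * x) := by
  have hbern : 1 - n * x ≤ (1 - x) ^ n := by
    have h := one_add_mul_le_pow (show (-2 : ℝ) ≤ -x by linarith) n
    have e1 : (1 : ℝ) + -x = 1 - x := by ring
    have e2 : (1 : ℝ) + n * -x = 1 - n * x := by ring
    rw [e1, e2] at h; exact h
  have hpos : 0 < 1 - n * x := by linarith
  have hprod : (1 + x) ^ n * (1 - x) ^ n ≤ 1 := by
    rw [← mul_pow]
    apply pow_le_one₀ (by nlinarith) (by nlinarith)
  rw [le_div_iff₀ hpos]
  calc (1 + x) ^ n * (1 - n * x) ≤ (1 + x) ^ n * (1 - x) ^ n :=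
        mul_le_mul_of_nonneg_left hbern (pow_nonneg (by linarith) n)
    _ ≤ 1 := hprod

/-! ### AP (58): the normalised first moment `f(1/2, ε₀)` from below -/

/-- **AP (58)** (crude form): `F_{λ₀}(1/2)/(2^k(1-ε₀)^k) ≥ 1 - 2/2^k - 16k/4^k` for `λ₀ = 1 - ε₀`,
`0 ≤ ε₀ ≤ 4/2^k`, `k ε₀ ≤ 1/2` (`F(1/2) = (2-2ε₀+ε₀²/2)^k - 2(1-ε₀/2)^k + 2^{-k}
≥ (2-2ε₀)^k - 2`). [cite: AchlioptasPeres2004, eq. (58) p. 17] -/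
theorem f_half_ge {k : ℕ} (hk1 : 1 ≤ k) {ε₀ : ℝ} (h0 : 0 ≤ ε₀) (h4 : ε₀ ≤ 4 / 2 ^ k)
    (hk : 2 * k * ε₀ ≤ 1) :
    1 - 2 / 2 ^ k - 16 * k / 4 ^ k ≤ pairPoly k (1 - ε₀) (1 / 2) / (2 ^ k * (1 - ε₀) ^ k) := by
  have h2k : (0 : ℝ) < 2 ^ k := pow_pos two_pos k
  have hε1 : ε₀ ≤ 1 / 2 := by
    have : (1 : ℝ) ≤ k := by exact_mod_cast hk1
    nlinarith
  have hl : 0 < 1 - ε₀ := by linarith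
  have hden : 0 < (2 : ℝ) ^ k * (1 - ε₀) ^ k := by positivity
  -- `F(1/2) ≥ (2(1-ε₀))^k - 2`
  have hF : (2 * (1 - ε₀)) ^ k - 2 ≤ pairPoly k (1 - ε₀) (1 / 2) := by
    unfold pairPoly
    have eA : (1 / 2 * (1 - ε₀) ^ 2 + 1 / 2 + 2 * (1 - ε₀) * (1 - 1 / 2) : ℝ) =
        2 * (1 - ε₀) + ε₀ ^ 2 / 2 := by ring
    have eB : (1 / 2 + (1 - ε₀) * (1 - 1 / 2) : ℝ) = 1 - ε₀ / 2 := by ring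
    rw [eA, eB]
    have h1 : (2 * (1 - ε₀)) ^ k ≤ (2 * (1 - ε₀) + ε₀ ^ 2 / 2) ^ k :=
      pow_le_pow_left₀ (by positivity) (by nlinarith) k
    have h2 : (1 - ε₀ / 2) ^ k ≤ 1 := pow_le_one₀ (by linarith) (by linarith)
    have h3 : (0 : ℝ) ≤ (1 / 2) ^ k := by positivity
    linarith
  rw [le_div_iff₀ hden]
  have hinv : 1 / (1 - ε₀) ^ k ≤ 1 + 2 * k * ε₀ := one_div_pow_le_one_add h0 hk
  -- `(1 - 2/2^k - 16k/4^k) 2^k (1-ε₀)^k ≤ 2^k(1-ε₀)^k - 2 ≤ F(1/2)`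
  have hpow1 : (1 - ε₀) ^ k ≤ 1 := pow_le_one₀ hl.le (by linarith)
  have hpowpos : 0 < (1 - ε₀) ^ k := pow_pos hl k
  have hkey : 2 ≤ (2 / 2 ^ k + 16 * k / 4 ^ k) * (2 ^ k * (1 - ε₀) ^ k) := by
    -- `2/(1-ε₀)^k ≤ 2(1 + 2kε₀) ≤ 2 + 16k/2^k` and the right side is `(2 + 16k/2^k)(1-ε₀)^k`
    have h4k : (4 : ℝ) ^ k = 2 ^ k * 2 ^ k := by rw [← mul_pow]; norm_num
    rw [h4k]
    have e : (2 / 2 ^ k + 16 * k / (2 ^ k * 2 ^ k)) * (2 ^ k * (1 - ε₀) ^ k) =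
        (2 + 16 * k / 2 ^ k) * (1 - ε₀) ^ k := by field_simp
    rw [e]
    have hk2 : 2 * k * ε₀ ≤ 8 * k / 2 ^ k := by
      rw [le_div_iff₀ h2k]
      have := mul_le_mul_of_nonneg_left h4 (by positivity : (0 : ℝ) ≤ 2 * k)
      have e2 : 2 * (k : ℝ) * (4 / 2 ^ k) * 2 ^ k = 8 * k := by field_simp; ring
      nlinarith [e2]
    -- from `1/(1-ε₀)^k ≤ 1 + 2kε₀`: `1 ≤ (1 + 2kε₀)(1-ε₀)^k`
    have h1 : 1 ≤ (1 + 2 * k * ε₀) * (1 - ε₀) ^ k := by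
      rw [div_le_iff₀ hpowpos] at hinv; linarith
    have h2 : (1 + 2 * k * ε₀) * (1 - ε₀) ^ k ≤ (1 + 8 * k / 2 ^ k) * (1 - ε₀) ^ k :=
      mul_le_mul_of_nonneg_right (by linarith) hpowpos.le
    have e3 : (2 + 16 * (k : ℝ) / 2 ^ k) * (1 - ε₀) ^ k = 2 * ((1 + 8 * k / 2 ^ k) * (1 - ε₀) ^ k) := by
      ring
    linarith
  have em : (2 * (1 - ε₀)) ^ k = 2 ^ k * (1 - ε₀) ^ k := mul_pow _ _ _
  have e4 : (1 - 2 / 2 ^ k - 16 * (k : ℝ) / 4 ^ k) * (2 ^ k * (1 - ε₀) ^ k) =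
      2 ^ k * (1 - ε₀) ^ k - (2 / 2 ^ k + 16 * k / 4 ^ k) * (2 ^ k * (1 - ε₀) ^ k) := by ring
  rw [em] at hF
  linarith

/-! ### AP (59)–(65): the difference `f(α, ε₁) - f(1/2, ε₀)` from above -/

/-- **AP (60)** (times `4^k`): with `ε₁ = ε₀/2`, the balance equation and `α ≥ 1/2`,
`[((2-ε₁)^k-1)² + k(2α-1)((2-ε₁)^{k-1}ε₁ - 1)²]/(1-ε₁)^k - ((2-ε₀)^k-1)²/(1-ε₀)^k
≤ αk/(2(1-ε₀)^{k+1})`. [cite: AchlioptasPeres2004, eq. (60)–(63) p. 18] -/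
theorem T2_sub_le {k : ℕ} (hk : 1 ≤ k) {ε₀ : ℝ} (hε₀ : 0 < ε₀) (hε₀1 : ε₀ < 1)
    (hbal : ε₀ * (2 - ε₀) ^ (k - 1) = 1)
    (hgrow : ((2 - ε₀ / 2) / (2 - ε₀)) ^ (k - 1) ≤ 3 / 2) {α : ℝ} (hα : 1 / 2 ≤ α) :
    (((2 - ε₀ / 2) ^ k - 1) ^ 2 + k * (2 * α - 1) * ((2 - ε₀ / 2) ^ (k - 1) * (ε₀ / 2) - 1) ^ 2) /
        (1 - ε₀ / 2) ^ k - ((2 - ε₀) ^ k - 1) ^ 2 / (1 - ε₀) ^ k ≤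
      α * k / (2 * (1 - ε₀) ^ (k + 1)) := by
  have hU3 := upsilon3_sub_le hk hε₀ hε₀1 hbal
  obtain ⟨_, _, hc1⟩ := coeff_one_sq_le hε₀ hε₀1.le hbal hgrow
  have hl0 : 0 < 1 - ε₀ := by linarith
  have hl1 : 0 < 1 - ε₀ / 2 := by linarith
  -- `(2-ε₀)^k ε₀ = 2 - ε₀ ≤ 2`
  have hKε : k * (2 - ε₀) ^ k / (1 - ε₀) ^ (k + 1) * (ε₀ / 8) ≤ k / (4 * (1 - ε₀) ^ (k + 1)) := by
    have e : (2 - ε₀) ^ k * ε₀ = 2 - ε₀ := by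
      have hk' : k = (k - 1) + 1 := (Nat.sub_add_cancel hk).symm
      conv_lhs => rw [hk', pow_succ]
      calc (2 - ε₀) ^ (k - 1) * (2 - ε₀) * ε₀ = (ε₀ * (2 - ε₀) ^ (k - 1)) * (2 - ε₀) := by ring
        _ = 2 - ε₀ := by rw [hbal, one_mul]
    have hpos : 0 < (1 - ε₀) ^ (k + 1) := pow_pos hl0 _
    rw [div_mul_eq_mul_div, div_le_div_iff₀ hpos (by positivity)]
    have : (k : ℝ) * (2 - ε₀) ^ k * (ε₀ / 8) = k * ((2 - ε₀) ^ k * ε₀) / 8 := by ring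
    rw [this, e]
    have hk0 : (0 : ℝ) ≤ k := Nat.cast_nonneg k
    nlinarith [mul_nonneg hk0 hε₀.le, hpos]
  -- the `c₁²` term: `k(2α-1)c₁²/(1-ε₁)^k ≤ k(2α-1)/(4(1-ε₀)^{k+1})`
  have hterm : k * (2 * α - 1) * ((2 - ε₀ / 2) ^ (k - 1) * (ε₀ / 2) - 1) ^ 2 / (1 - ε₀ / 2) ^ k ≤
      k * (2 * α - 1) / (4 * (1 - ε₀) ^ (k + 1)) := by
    have hpow : (1 - ε₀) ^ (k + 1) ≤ (1 - ε₀ / 2) ^ k := by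
      calc (1 - ε₀) ^ (k + 1) = (1 - ε₀) ^ k * (1 - ε₀) := pow_succ _ _
        _ ≤ (1 - ε₀) ^ k * 1 := mul_le_mul_of_nonneg_left (by linarith) (pow_nonneg hl0.le k)
        _ = (1 - ε₀) ^ k := mul_one _
        _ ≤ (1 - ε₀ / 2) ^ k := pow_le_pow_left₀ hl0.le (by linarith) k
    have hnum0 : 0 ≤ k * (2 * α - 1) := by
      have : (0 : ℝ) ≤ k := Nat.cast_nonneg k
      nlinarith
    calc k * (2 * α - 1) * ((2 - ε₀ / 2) ^ (k - 1) * (ε₀ / 2) - 1) ^ 2 / (1 - ε₀ / 2) ^ k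
        ≤ k * (2 * α - 1) * (1 / 4) / (1 - ε₀ / 2) ^ k := by
          apply div_le_div_of_nonneg_right _ (pow_nonneg hl1.le k)
          exact mul_le_mul_of_nonneg_left hc1 hnum0
      _ ≤ k * (2 * α - 1) * (1 / 4) / (1 - ε₀) ^ (k + 1) :=
          div_le_div_of_nonneg_left (by positivity) (pow_pos hl0 _) hpow
      _ = k * (2 * α - 1) / (4 * (1 - ε₀) ^ (k + 1)) := by rw [mul_one_div, div_div]
  rw [add_div]
  have hD : (0 : ℝ) < (1 - ε₀) ^ (k + 1) := pow_pos hl0 _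
  have e : k / (4 * (1 - ε₀) ^ (k + 1)) + k * (2 * α - 1) / (4 * (1 - ε₀) ^ (k + 1)) =
      α * k / (2 * (1 - ε₀) ^ (k + 1)) := by
    rw [← add_div, div_eq_div_iff (by positivity) (by positivity)]; ring
  rw [← e]
  linarith

/-- The numerator algebra of AP (64)–(65): for `0 ≤ α ≤ 1`, `k ≥ 1`,
`(αk/2)(1 + 8(k+1)/2^k) + ((2α)^k - 1 - 2k(α - 1/2)) ≤ 2^k (α^k - 3αk/2^{k+1} + (k-1)/2^k + 8k²/4^k)`.
[cite: AchlioptasPeres2004, eq. (64)–(65) p. 19] -/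
theorem fdiff_numer_le {k : ℕ} (hk1 : 1 ≤ k) {α : ℝ} (hα1 : α ≤ 1) :
    α * k / 2 * (1 + 8 * (k + 1) / 2 ^ k) + ((2 * α) ^ k - 1 - 2 * k * (α - 1 / 2)) ≤
      2 ^ k * (α ^ k - 3 * α * k / 2 ^ (k + 1) + (k - 1) / 2 ^ k + 8 * k ^ 2 / 4 ^ k) := by
  have h2k : (0 : ℝ) < 2 ^ k := pow_pos two_pos k
  have h4k : (4 : ℝ) ^ k = 2 ^ k * 2 ^ k := by rw [← mul_pow]; norm_num
  have hk1' : (1 : ℝ) ≤ k := by exact_mod_cast hk1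
  have hkk : α * k * (k + 1) ≤ 2 * (k : ℝ) ^ 2 := by
    have h1 : α * k * (k + 1) ≤ 1 * k * (k + 1) := by
      apply mul_le_mul_of_nonneg_right (mul_le_mul_of_nonneg_right hα1 (by positivity))
      positivity
    have h2 : (k : ℝ) ≤ k ^ 2 := by nlinarith
    nlinarith
  -- clear denominators: multiply by `2^k > 0`
  rw [mul_pow, h4k, pow_succ]
  rw [← sub_nonneg]
  have e : 2 ^ k * (α ^ k - 3 * α * k / (2 ^ k * 2) + (k - 1) / 2 ^ k + 8 * k ^ 2 / (2 ^ k * 2 ^ k)) -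
      (α * k / 2 * (1 + 8 * (k + 1) / 2 ^ k) + ((2 : ℝ) ^ k * α ^ k - 1 - 2 * k * (α - 1 / 2))) =
      (8 * k ^ 2 - 4 * (α * k * (k + 1))) / 2 ^ k := by
    field_simp
    ring
  rw [e]
  exact div_nonneg (by linarith) h2k.le

set_option maxHeartbeats 800000 in
-- a long chain of explicit estimates; the default heartbeat budget is too small for one declaration
/-- **AP (59), (64)–(65)**: for `ε₁ = ε₀/2`, `1/2 ≤ α ≤ 1`,
`f(α,ε₁) - f(1/2,ε₀) ≤ (α^k - 3αk/2^{k+1} + (k-1)/2^k + 8k²/4^k)/(2^k(1-ε₁)^k)`, where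
`f(α,ε) = F_{1-ε}(α)/(2^k(1-ε)^k)` (AP's normalisation). Ingredients: the expansion bound
`two_pow_mul_pairPoly_half_add_le` (coefficients `|c_j(λ₁)| ≤ 1`), `T2_sub_le` (60), and
`(1-ε₁)^k/(1-ε₀)^{k+1} ≤ 1 + 8(k+1)/2^k`. [cite: AchlioptasPeres2004, eq. (59) p. 18, (64)–(65) p. 19] -/
theorem fdiff_le {k : ℕ} (hk : 2 ≤ k) {ε₀ : ℝ} (hε₀ : 0 < ε₀) (hε₀4 : ε₀ ≤ 4 / 2 ^ k)
    (hkε : 2 * (k + 1) * ε₀ ≤ 1) (hbal : ε₀ * (2 - ε₀) ^ (k - 1) = 1)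
    (hgrow : ((2 - ε₀ / 2) / (2 - ε₀)) ^ (k - 1) ≤ 3 / 2) {α : ℝ} (hα : 1 / 2 ≤ α) (hα1 : α ≤ 1) :
    pairPoly k (1 - ε₀ / 2) α / (2 ^ k * (1 - ε₀ / 2) ^ k) -
        pairPoly k (1 - ε₀) (1 / 2) / (2 ^ k * (1 - ε₀) ^ k) ≤
      (α ^ k - 3 * α * k / 2 ^ (k + 1) + (k - 1) / 2 ^ k + 8 * k ^ 2 / 4 ^ k) /
        (2 ^ k * (1 - ε₀ / 2) ^ k) := by
  have hk1 : 1 ≤ k := by omega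
  have h2k : (0 : ℝ) < 2 ^ k := pow_pos two_pos k
  have h4k : (4 : ℝ) ^ k = 2 ^ k * 2 ^ k := by rw [← mul_pow]; norm_num
  have hkε' : 2 * k * ε₀ ≤ 1 := by nlinarith [mul_nonneg (Nat.cast_nonneg k) hε₀.le]
  have hε₀1 : ε₀ < 1 := by
    have : (2 : ℝ) ≤ k := by exact_mod_cast hk
    nlinarith
  have hl0 : 0 < 1 - ε₀ := by linarith
  have hl1 : 0 < 1 - ε₀ / 2 := by linarith
  have hD1 : 0 < (2 : ℝ) ^ k * (1 - ε₀ / 2) ^ k := by positivity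
  have hD0 : 0 < (2 : ℝ) ^ k * (1 - ε₀) ^ k := by positivity
  -- coefficient bounds for `λ₁ = 1 - ε₀/2`
  obtain ⟨_, hup, _⟩ := coeff_one_sq_le hε₀ hε₀1.le hbal hgrow
  have hcoef : ∀ j, 2 ≤ j → j ≤ k →
      |(1 + (1 - ε₀ / 2)) ^ (k - j) * (1 - (1 - ε₀ / 2)) ^ j - 1| ≤ 1 := by
    intro j hj hjk
    have e1 : (1 : ℝ) + (1 - ε₀ / 2) = 2 - ε₀ / 2 := by ring
    have e2 : (1 : ℝ) - (1 - ε₀ / 2) = ε₀ / 2 := by ring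
    rw [e1, e2]
    exact abs_coeff_le_one hj hjk (by linarith) (by linarith) (le_trans hup (by norm_num))
  -- (59): `2^k F₁(α) ≤ c₀² + k(2α-1)c₁² + ((2α)^k - 1 - k(2α-1))`
  have h59 := two_pow_mul_pairPoly_half_add_le hk hcoef (x := α - 1 / 2) (by linarith)
  have e1 : (1 : ℝ) + (1 - ε₀ / 2) = 2 - ε₀ / 2 := by ring
  have e2 : (1 : ℝ) - (1 - ε₀ / 2) = ε₀ / 2 := by ring
  have e3 : (1 : ℝ) / 2 + (α - 1 / 2) = α := by ring
  have e4 : (1 : ℝ) + 2 * (α - 1 / 2) = 2 * α := by ring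
  rw [e1, e2, e3, e4] at h59
  -- (60)
  have h60 := T2_sub_le hk1 hε₀ hε₀1 hbal hgrow hα
  -- `F₀(1/2) = c₀(λ₀)²/2^k`
  have hF0 : pairPoly k (1 - ε₀) (1 / 2) = ((2 - ε₀) ^ k - 1) ^ 2 / 2 ^ k := by
    rw [pairPoly_half]; congr 2; ring
  -- `R₀₁ = (1-ε₁)^k/(1-ε₀)^{k+1} ≤ 1 + 8(k+1)/2^k`
  have hR : 1 / (1 - ε₀) ^ (k + 1) ≤ 1 + 8 * (k + 1) / 2 ^ k := by
    have h := one_div_pow_le_one_add (n := k + 1) hε₀.le (by push_cast; linarith)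
    push_cast at h
    have : 2 * ((k : ℝ) + 1) * ε₀ ≤ 8 * (k + 1) / 2 ^ k := by
      rw [le_div_iff₀ h2k]
      have := mul_le_mul_of_nonneg_left hε₀4 (by positivity : (0 : ℝ) ≤ 2 * (k + 1))
      have e : 2 * ((k : ℝ) + 1) * (4 / 2 ^ k) * 2 ^ k = 8 * (k + 1) := by field_simp; ring
      nlinarith [e]
    linarith
  -- assemble: everything over the denominator `4^k (1-ε₁)^k`
  set c0 : ℝ := ((2 - ε₀ / 2) ^ k - 1) ^ 2 with hc0
  set c1t : ℝ := k * (2 * α - 1) * ((2 - ε₀ / 2) ^ (k - 1) * (ε₀ / 2) - 1) ^ 2 with hc1t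
  set tail : ℝ := (2 * α) ^ k - 1 - 2 * k * (α - 1 / 2) with htail
  have htail0 : 0 ≤ tail := by
    -- `(2α)^k ≥ 1 + k(2α - 1)` (Bernoulli)
    have h := one_add_mul_le_pow (show (-2 : ℝ) ≤ 2 * α - 1 by linarith) k
    have e : (1 : ℝ) + (2 * α - 1) = 2 * α := by ring
    rw [e] at h
    simp only [htail]; nlinarith
  -- Step 1: `F₁/D₁ ≤ (c0 + c1t + tail)/(4^k (1-ε₁)^k)`
  have hstep1 : pairPoly k (1 - ε₀ / 2) α / (2 ^ k * (1 - ε₀ / 2) ^ k) ≤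
      (c0 + c1t + tail) / (4 ^ k * (1 - ε₀ / 2) ^ k) := by
    rw [h4k, div_le_div_iff₀ hD1 (by positivity)]
    have hpos : 0 ≤ (1 - ε₀ / 2) ^ k := pow_nonneg hl1.le k
    have : pairPoly k (1 - ε₀ / 2) α * 2 ^ k ≤ c0 + c1t + tail := by
      have e5 : 2 * (k : ℝ) * (α - 1 / 2) = k * (2 * α - 1) := by ring
      rw [e5] at h59
      simp only [hc0, hc1t, htail]
      linarith
    calc pairPoly k (1 - ε₀ / 2) α * (2 ^ k * 2 ^ k * (1 - ε₀ / 2) ^ k)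
        = (pairPoly k (1 - ε₀ / 2) α * 2 ^ k) * (2 ^ k * (1 - ε₀ / 2) ^ k) := by ring
      _ ≤ (c0 + c1t + tail) * (2 ^ k * (1 - ε₀ / 2) ^ k) :=
          mul_le_mul_of_nonneg_right this hD1.le
  -- Step 2: `F₀(1/2)/D₀ = c0(λ₀)²/(4^k(1-ε₀)^k)`
  have hstep2 : pairPoly k (1 - ε₀) (1 / 2) / (2 ^ k * (1 - ε₀) ^ k) =
      ((2 - ε₀) ^ k - 1) ^ 2 / (4 ^ k * (1 - ε₀) ^ k) := by
    rw [hF0, h4k, div_div]; ring_nf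
  -- Step 3: (60) divided by `4^k`
  have hstep3 : (c0 + c1t) / (4 ^ k * (1 - ε₀ / 2) ^ k) - ((2 - ε₀) ^ k - 1) ^ 2 / (4 ^ k * (1 - ε₀) ^ k)
      ≤ α * k / (2 * (1 - ε₀) ^ (k + 1)) / 4 ^ k := by
    have h4pos : (0 : ℝ) < 4 ^ k := by positivity
    have e : (c0 + c1t) / (4 ^ k * (1 - ε₀ / 2) ^ k) - ((2 - ε₀) ^ k - 1) ^ 2 / (4 ^ k * (1 - ε₀) ^ k)
        = ((c0 + c1t) / (1 - ε₀ / 2) ^ k - ((2 - ε₀) ^ k - 1) ^ 2 / (1 - ε₀) ^ k) / 4 ^ k := by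
      field_simp
    rw [e]
    exact div_le_div_of_nonneg_right (by simpa [hc0, hc1t] using h60) h4pos.le
  -- Step 4: `αk/(2(1-ε₀)^{k+1}) ≤ (αk/2)(1 + 8(k+1)/2^k)/(1-ε₁)^k`
  have hstep4 : α * k / (2 * (1 - ε₀) ^ (k + 1)) ≤
      α * k / 2 * (1 + 8 * (k + 1) / 2 ^ k) / (1 - ε₀ / 2) ^ k := by
    have hp1 : 0 < (1 - ε₀ / 2) ^ k := pow_pos hl1 k
    have hp0 : 0 < (1 - ε₀) ^ (k + 1) := pow_pos hl0 _
    have hle1 : (1 - ε₀ / 2) ^ k ≤ 1 := pow_le_one₀ hl1.le (by linarith)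
    rw [le_div_iff₀ hp1]
    calc α * k / (2 * (1 - ε₀) ^ (k + 1)) * (1 - ε₀ / 2) ^ k
        ≤ α * k / (2 * (1 - ε₀) ^ (k + 1)) * 1 :=
          mul_le_mul_of_nonneg_left hle1 (by positivity)
      _ = α * k / 2 * (1 / (1 - ε₀) ^ (k + 1)) := by field_simp
      _ ≤ α * k / 2 * (1 + 8 * (k + 1) / 2 ^ k) :=
          mul_le_mul_of_nonneg_left hR (by positivity)
  -- Step 5: numerator algebra
  have hnum : α * k / 2 * (1 + 8 * (k + 1) / 2 ^ k) + tail ≤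
      2 ^ k * (α ^ k - 3 * α * k / 2 ^ (k + 1) + (k - 1) / 2 ^ k + 8 * k ^ 2 / 4 ^ k) := by
    simp only [htail]
    exact fdiff_numer_le hk1 hα1
  -- combine
  have h4pos : (0 : ℝ) < 4 ^ k := by positivity
  have hp1 : 0 < (1 - ε₀ / 2) ^ k := pow_pos hl1 k
  calc pairPoly k (1 - ε₀ / 2) α / (2 ^ k * (1 - ε₀ / 2) ^ k) -
        pairPoly k (1 - ε₀) (1 / 2) / (2 ^ k * (1 - ε₀) ^ k)
      ≤ (c0 + c1t + tail) / (4 ^ k * (1 - ε₀ / 2) ^ k) -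
          ((2 - ε₀) ^ k - 1) ^ 2 / (4 ^ k * (1 - ε₀) ^ k) := by rw [hstep2]; linarith [hstep1]
    _ = ((c0 + c1t) / (4 ^ k * (1 - ε₀ / 2) ^ k) - ((2 - ε₀) ^ k - 1) ^ 2 / (4 ^ k * (1 - ε₀) ^ k))
          + tail / (4 ^ k * (1 - ε₀ / 2) ^ k) := by rw [add_div]; ring
    _ ≤ α * k / (2 * (1 - ε₀) ^ (k + 1)) / 4 ^ k + tail / (4 ^ k * (1 - ε₀ / 2) ^ k) := by
          linarith [hstep3]
    _ ≤ (α * k / 2 * (1 + 8 * (k + 1) / 2 ^ k) / (1 - ε₀ / 2) ^ k) / 4 ^ k +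
          tail / (4 ^ k * (1 - ε₀ / 2) ^ k) := by
          have := div_le_div_of_nonneg_right hstep4 h4pos.le
          linarith
    _ = (α * k / 2 * (1 + 8 * (k + 1) / 2 ^ k) + tail) / (4 ^ k * (1 - ε₀ / 2) ^ k) := by
          field_simp
    _ ≤ 2 ^ k * (α ^ k - 3 * α * k / 2 ^ (k + 1) + (k - 1) / 2 ^ k + 8 * k ^ 2 / 4 ^ k) /
          (4 ^ k * (1 - ε₀ / 2) ^ k) := div_le_div_of_nonneg_right hnum (by positivity)
    _ = (α ^ k - 3 * α * k / 2 ^ (k + 1) + (k - 1) / 2 ^ k + 8 * k ^ 2 / 4 ^ k) /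
          (2 ^ k * (1 - ε₀ / 2) ^ k) := by
          rw [h4k]; field_simp

/-! ### Numerical facts for `k ≥ 7` -/

/-- `16k ≤ 2^k` for `k ≥ 7`. [folklore] -/
theorem sixteen_mul_le_two_pow {k : ℕ} (hk : 7 ≤ k) : 16 * (k : ℝ) ≤ 2 ^ k := by
  have h : ∀ n : ℕ, 16 * ((n + 7 : ℕ) : ℝ) ≤ 2 ^ (n + 7) := by
    intro n
    induction n with
    | zero => norm_num
    | succ n ih =>
      have : (2 : ℝ) ^ (n + 1 + 7) = 2 * 2 ^ (n + 7) := by ring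
      rw [this]; push_cast at ih ⊢; nlinarith
  obtain ⟨n, rfl⟩ : ∃ n, k = n + 7 := ⟨k - 7, by omega⟩
  exact h n

/-- `3k ≤ (9/5)^k` for `k ≥ 7` (so that `3k/2^k ≤ (9/10)^k`). [folklore] -/
theorem three_mul_le_pow {k : ℕ} (hk : 7 ≤ k) : 3 * (k : ℝ) ≤ (9 / 5) ^ k := by
  have h : ∀ n : ℕ, 3 * ((n + 7 : ℕ) : ℝ) ≤ (9 / 5) ^ (n + 7) := by
    intro n
    induction n with
    | zero => norm_num
    | succ n ih =>
      have : ((9 : ℝ) / 5) ^ (n + 1 + 7) = 9 / 5 * (9 / 5) ^ (n + 7) := by ring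
      rw [this]; push_cast at ih ⊢; nlinarith
  obtain ⟨n, rfl⟩ : ∃ n, k = n + 7 := ⟨k - 7, by omega⟩
  exact h n

/-! ### AP (66)–(67) and p. 19: the lower bound for `1/w` -/

set_option maxHeartbeats 400000 in
-- many explicit estimates in one declaration
/-- **AP (66)–(67) and the identity on p. 19**: for `k ≥ 7`, `9/10 ≤ α ≤ 1`, `0 < t ≤ 1`,
with `N = α^k - 3αk/2^{k+1} + (k-1)/2^k + 8k²/4^k` (the numerator of `fdiff_le`),
`t (2^k - 2 - 16k/2^k)/N ≥ t (B - αC) - 1/2 - (k+2)/2^k - 32k²(50/81)^k - 32k(5/9)^k`,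
`B = 2^k(k+1) - 3k - 1/2`, `C = k(2^k - 7/2)` (via `1/(α^k - q) ≥ 1 + k(1-α) + q`,
`q = 3αk/2^{k+1} - (k-1)/2^k`). [cite: AchlioptasPeres2004, eq. (66)–(71) pp. 19–20] -/
theorem inv_w_lower {k : ℕ} (hk : 7 ≤ k) {α t : ℝ} (hα : 9 / 10 ≤ α) (hα1 : α ≤ 1)
    (ht0 : 0 < t) (ht1 : t ≤ 1) :
    t * ((2 ^ k * (k + 1) - 3 * k - 1 / 2) - α * (k * (2 ^ k - 7 / 2))) - 1 / 2 - (k + 2) / 2 ^ k -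
        32 * k ^ 2 * (50 / 81) ^ k - 32 * k * (5 / 9) ^ k ≤
      t * (2 ^ k - 2 - 16 * k / 2 ^ k) /
        (α ^ k - 3 * α * k / 2 ^ (k + 1) + (k - 1) / 2 ^ k + 8 * k ^ 2 / 4 ^ k) := by
  have h2k : (0 : ℝ) < 2 ^ k := pow_pos two_pos k
  have h4k : (4 : ℝ) ^ k = 2 ^ k * 2 ^ k := by rw [← mul_pow]; norm_num
  have hk1 : (7 : ℝ) ≤ k := by exact_mod_cast hk
  have h16 := sixteen_mul_le_two_pow hk
  have h3 := three_mul_le_pow hk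
  -- `q` and `D₀ = α^k - q`
  set q : ℝ := 3 * α * k / 2 ^ (k + 1) - (k - 1) / 2 ^ k with hq
  set D : ℝ := α ^ k - q with hD
  set N : ℝ := α ^ k - 3 * α * k / 2 ^ (k + 1) + (k - 1) / 2 ^ k + 8 * k ^ 2 / 4 ^ k with hN
  have hND : N = D + 8 * k ^ 2 / 4 ^ k := by simp only [hN, hD, hq]; ring
  -- `α^k ≥ (9/10)^k ≥ 3k/2^k ≥ 2q`
  have hαk : (9 / 10 : ℝ) ^ k ≤ α ^ k := pow_le_pow_left₀ (by norm_num) hα k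
  have h910 : 3 * (k : ℝ) / 2 ^ k ≤ (9 / 10) ^ k := by
    rw [div_le_iff₀ h2k, show ((9 : ℝ) / 10) ^ k * 2 ^ k = (9 / 5) ^ k by rw [← mul_pow]; norm_num]
    exact h3
  have hq0 : 0 ≤ q := by
    simp only [hq]; rw [pow_succ]
    rw [sub_nonneg, div_le_div_iff₀ h2k (by positivity)]
    have hh := mul_le_mul_of_nonneg_right hα (by positivity : (0 : ℝ) ≤ k * 2 ^ k)
    nlinarith [hh, h2k]
  have hqle : q ≤ 3 * k / 2 ^ (k + 1) := by
    simp only [hq]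
    have h1 : 3 * α * k / 2 ^ (k + 1) ≤ 3 * k / 2 ^ (k + 1) := by
      apply div_le_div_of_nonneg_right _ (by positivity); nlinarith
    have h2 : 0 ≤ ((k : ℝ) - 1) / 2 ^ k := by apply div_nonneg _ h2k.le; linarith
    linarith
  have hq2 : 2 * q ≤ α ^ k := by
    have : 3 * (k : ℝ) / 2 ^ (k + 1) = (3 * k / 2 ^ k) / 2 := by rw [pow_succ]; field_simp
    rw [this] at hqle
    linarith
  have hDpos : (9 / 10 : ℝ) ^ k / 2 ≤ D := by simp only [hD]; linarith
  have h9pos : (0 : ℝ) < (9 / 10) ^ k := by positivity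
  have hD0 : 0 < D := lt_of_lt_of_le (by positivity) hDpos
  have hN0 : 0 < N := by rw [hND]; positivity
  have hNge : (9 / 10 : ℝ) ^ k / 2 ≤ N := by rw [hND]; linarith [hDpos, (by positivity : (0:ℝ) ≤ 8 * k ^ 2 / 4 ^ k)]
  have hqlt : q < α ^ k := by linarith [h9pos]
  -- Step a: `(2^k-2)/D - (2^k-2-16k/2^k)/N ≤ (8k²/2^k + 16k D/2^k)/(D N)`
  have hstepA : (2 ^ k - 2) / D - (2 ^ k - 2 - 16 * k / 2 ^ k) / N ≤
      (8 * k ^ 2 / 2 ^ k + 16 * k * D / 2 ^ k) / (D * N) := by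
    rw [div_sub_div _ _ hD0.ne' hN0.ne', div_le_div_iff_of_pos_right (mul_pos hD0 hN0)]
    rw [hND, h4k]
    -- `(2^k-2) · 8k²/(2^k 2^k) ≤ 8k²/2^k`
    have hk2 : 0 ≤ 8 * (k : ℝ) ^ 2 := by positivity
    have h1 : (2 ^ k - 2) * (8 * (k : ℝ) ^ 2 / (2 ^ k * 2 ^ k)) ≤ 8 * k ^ 2 / 2 ^ k := by
      rw [show (2 ^ k - 2) * (8 * (k : ℝ) ^ 2 / (2 ^ k * 2 ^ k)) = (8 * k ^ 2 / 2 ^ k) * ((2 ^ k - 2) / 2 ^ k)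
        by field_simp]
      have : (2 ^ k - 2) / (2 : ℝ) ^ k ≤ 1 := by rw [div_le_one h2k]; linarith
      have hp : 0 ≤ 8 * (k : ℝ) ^ 2 / 2 ^ k := by positivity
      nlinarith
    have e : (2 ^ k - 2) * (D + 8 * (k : ℝ) ^ 2 / (2 ^ k * 2 ^ k)) - D * (2 ^ k - 2 - 16 * k / 2 ^ k) =
        (2 ^ k - 2) * (8 * (k : ℝ) ^ 2 / (2 ^ k * 2 ^ k)) + 16 * k * D / 2 ^ k := by ring
    rw [e]
    linarith [h1]
  -- Step b: the error is at most `32k²(50/81)^k + 32k(5/9)^k`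
  have hstepB : (8 * k ^ 2 / 2 ^ k + 16 * k * D / 2 ^ k) / (D * N) ≤
      32 * k ^ 2 * (50 / 81) ^ k + 32 * k * (5 / 9) ^ k := by
    rw [add_div]
    have hb1 : 8 * (k : ℝ) ^ 2 / 2 ^ k / (D * N) ≤ 32 * k ^ 2 * (50 / 81) ^ k := by
      -- `D N ≥ (9/10)^{2k}/4`, `2^k (81/100)^k = (81/50)^k`
      have hDN : (9 / 10 : ℝ) ^ k / 2 * ((9 / 10) ^ k / 2) ≤ D * N :=
        mul_le_mul hDpos hNge (by positivity) hD0.le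
      rw [div_div, div_le_iff₀ (by positivity)]
      have e : (32 : ℝ) * (k : ℝ) ^ 2 * (50 / 81) ^ k * (2 ^ k * ((9 / 10) ^ k / 2 * ((9 / 10) ^ k / 2))) =
          8 * (k : ℝ) ^ 2 * ((50 / 81) * 2 * (9 / 10) * (9 / 10)) ^ k := by
        rw [mul_pow, mul_pow, mul_pow]; ring
      have e1 : ((50 : ℝ) / 81 * 2 * (9 / 10) * (9 / 10)) = 1 := by norm_num
      calc 8 * (k : ℝ) ^ 2 = 8 * (k : ℝ) ^ 2 * ((50 / 81) * 2 * (9 / 10) * (9 / 10)) ^ k := by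
            rw [e1]; ring
        _ = 32 * (k : ℝ) ^ 2 * (50 / 81) ^ k * (2 ^ k * ((9 / 10) ^ k / 2 * ((9 / 10) ^ k / 2))) := e.symm
        _ ≤ 32 * (k : ℝ) ^ 2 * (50 / 81) ^ k * (2 ^ k * (D * N)) := by
            apply mul_le_mul_of_nonneg_left _ (by positivity)
            exact mul_le_mul_of_nonneg_left hDN h2k.le
    have hb2 : 16 * (k : ℝ) * D / 2 ^ k / (D * N) ≤ 32 * k * (5 / 9) ^ k := by
      rw [show 16 * (k : ℝ) * D / 2 ^ k / (D * N) = 16 * k / (2 ^ k * N) by field_simp]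
      rw [div_le_iff₀ (by positivity)]
      have e : (32 : ℝ) * (k : ℝ) * (5 / 9) ^ k * (2 ^ k * ((9 / 10) ^ k / 2)) =
          16 * (k : ℝ) * ((5 / 9) * 2 * (9 / 10)) ^ k := by rw [mul_pow, mul_pow]; ring
      have e1 : ((5 : ℝ) / 9 * 2 * (9 / 10)) = 1 := by norm_num
      calc 16 * (k : ℝ) = 16 * (k : ℝ) * ((5 / 9) * 2 * (9 / 10)) ^ k := by rw [e1]; ring
        _ = 32 * (k : ℝ) * (5 / 9) ^ k * (2 ^ k * ((9 / 10) ^ k / 2)) := e.symm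
        _ ≤ 32 * (k : ℝ) * (5 / 9) ^ k * (2 ^ k * N) := by
            apply mul_le_mul_of_nonneg_left _ (by positivity)
            exact mul_le_mul_of_nonneg_left hNge h2k.le
    linarith
  -- Step c: `1/D ≥ 1 + k(1-α) + q`
  have hstepC : 1 + k * (1 - α) + q ≤ 1 / D := one_add_le_inv_pow_sub (by linarith) hα1 hq0 hqlt
  have h2k2 : (0 : ℝ) ≤ 2 ^ k - 2 := by linarith [h16]
  have hstepC' : (2 ^ k - 2) * (1 + k * (1 - α) + q) ≤ (2 ^ k - 2) / D := by
    rw [div_eq_mul_one_div]; exact mul_le_mul_of_nonneg_left hstepC h2k2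
  -- Step d: the identity
  have hstepD : (2 ^ k - 2) * (1 + k * (1 - α) + q) =
      ((2 ^ k * (k + 1) - 3 * k - 1 / 2) - α * (k * (2 ^ k - 7 / 2))) - 1 / 2 +
        (2 * (k - 1) - 3 * α * k) / 2 ^ k := by
    simp only [hq]; rw [pow_succ]; field_simp; ring
  -- Step e: assemble
  have hsmall : t * ((2 * (k - 1) - 3 * α * k) / 2 ^ k) ≥ -((k + 2) / 2 ^ k) := by
    by_cases hs : 0 ≤ (2 * ((k : ℝ) - 1) - 3 * α * k) / 2 ^ k
    · have : 0 ≤ t * ((2 * (k - 1) - 3 * α * k) / 2 ^ k) := mul_nonneg ht0.le hs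
      have : 0 ≤ ((k : ℝ) + 2) / 2 ^ k := by positivity
      linarith
    · push Not at hs
      have hlow : -((k + 2) / 2 ^ k) ≤ (2 * ((k : ℝ) - 1) - 3 * α * k) / 2 ^ k := by
        rw [show -(((k : ℝ) + 2) / 2 ^ k) = (-(k + 2)) / 2 ^ k by ring]
        apply div_le_div_of_nonneg_right _ h2k.le
        nlinarith
      -- `t · s ≥ s` for `s < 0`, `t ≤ 1`
      nlinarith
  have hmain : t * ((2 ^ k - 2) / D) - (32 * k ^ 2 * (50 / 81) ^ k + 32 * k * (5 / 9) ^ k) ≤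
      t * (2 ^ k - 2 - 16 * k / 2 ^ k) / N := by
    have h1 : (2 ^ k - 2) / D - (32 * k ^ 2 * (50 / 81) ^ k + 32 * k * (5 / 9) ^ k) ≤
        (2 ^ k - 2 - 16 * k / 2 ^ k) / N := by linarith [hstepA, hstepB]
    have h2 := mul_le_mul_of_nonneg_left h1 ht0.le
    have herr0 : 0 ≤ 32 * (k : ℝ) ^ 2 * (50 / 81) ^ k + 32 * k * (5 / 9) ^ k := by positivity
    have e : t * ((2 ^ k - 2) / D - (32 * (k : ℝ) ^ 2 * (50 / 81) ^ k + 32 * k * (5 / 9) ^ k)) =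
        t * ((2 ^ k - 2) / D) - t * (32 * (k : ℝ) ^ 2 * (50 / 81) ^ k + 32 * k * (5 / 9) ^ k) := by
      ring
    rw [e] at h2
    have h3 : t * (32 * (k : ℝ) ^ 2 * (50 / 81) ^ k + 32 * k * (5 / 9) ^ k) ≤
        1 * (32 * (k : ℝ) ^ 2 * (50 / 81) ^ k + 32 * k * (5 / 9) ^ k) :=
      mul_le_mul_of_nonneg_right ht1 herr0
    rw [mul_div_assoc]
    linarith
  have hC2 := mul_le_mul_of_nonneg_left hstepC' ht0.le
  rw [hstepD] at hC2
  have e : t * (2 ^ k * ((k : ℝ) + 1) - 3 * k - 1 / 2 - α * (k * (2 ^ k - 7 / 2)) - 1 / 2 +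
      (2 * (k - 1) - 3 * α * k) / 2 ^ k) =
      t * ((2 ^ k * (k + 1) - 3 * k - 1 / 2) - α * (k * (2 ^ k - 7 / 2))) - t / 2 +
        t * ((2 * (k - 1) - 3 * α * k) / 2 ^ k) := by ring
  rw [e] at hC2
  have ht2 : t / 2 ≤ 1 / 2 := by linarith
  linarith [hC2, hmain, hsmall]

set_option maxHeartbeats 800000 in
-- the assembly of many explicit estimates
/-- **Reduction of AP (56) to the sufficient condition** (AP (57)–(67)): for `k ≥ 7`, the
balancing `ε₀` (`ε₀(2-ε₀)^{k-1} = 1`, `2/2^k ≤ ε₀ ≤ 2/2^k + 8k/4^k`), `ε₁ = ε₀/2`,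
`9/10 ≤ α ≤ 1`, and `W = ((1-ε₀)/(1-ε₁))^k F_{λ₁}(α)/F_{λ₀}(1/2) > 1`: if `0 ≤ r ≤
S ((1-ε₁)^k (B - αC) - E_k)` with `S ≥ 0`, `B = 2^k(k+1) - 3k - 1/2`, `C = k(2^k - 7/2)`,
`E_k = (k+3)/2^k + 32k²(50/81)^k + 32k(5/9)^k`, then `r log W ≤ S`. (With `S = spinRate(2α-1)
= log 2 - h(α)` this is AP (56): `g_r(1/2, ε₀) ≥ g_r(α, ε₁)`.)
[cite: AchlioptasPeres2004, Lemma 9 and eq. (56)–(67) (arXiv:cs/0305009 pp. 17–19)] -/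
theorem optionB_of_le {k : ℕ} (hk : 7 ≤ k) {ε₀ : ℝ} (hbal : ε₀ * (2 - ε₀) ^ (k - 1) = 1)
    (hε₀l : 2 / 2 ^ k ≤ ε₀) (hε₀u : ε₀ ≤ 2 / 2 ^ k + 8 * k / 4 ^ k)
    {α : ℝ} (hα : 9 / 10 ≤ α) (hα1 : α ≤ 1)
    (hW : 1 < ((1 - ε₀) / (1 - ε₀ / 2)) ^ k * pairPoly k (1 - ε₀ / 2) α / pairPoly k (1 - ε₀) (1 / 2))
    {S r : ℝ} (hS : 0 ≤ S) (hr0 : 0 ≤ r)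
    (hr : r ≤ S * ((1 - ε₀ / 2) ^ k * ((2 ^ k * (k + 1) - 3 * k - 1 / 2) - α * (k * (2 ^ k - 7 / 2))) -
      ((k + 3) / 2 ^ k + 32 * k ^ 2 * (50 / 81) ^ k + 32 * k * (5 / 9) ^ k))) :
    r * Real.log (((1 - ε₀) / (1 - ε₀ / 2)) ^ k * pairPoly k (1 - ε₀ / 2) α /
      pairPoly k (1 - ε₀) (1 / 2)) ≤ S := by
  -- numerics
  have h2k : (0 : ℝ) < 2 ^ k := pow_pos two_pos k
  have h4k : (4 : ℝ) ^ k = 2 ^ k * 2 ^ k := by rw [← mul_pow]; norm_num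
  have h16 := sixteen_mul_le_two_pow hk
  have hk7 : (7 : ℝ) ≤ k := by exact_mod_cast hk
  have h112 : (112 : ℝ) ≤ 2 ^ k := by linarith
  -- ε facts
  have hε₀ : 0 < ε₀ := lt_of_lt_of_le (by positivity) hε₀l
  have hε₀4 : ε₀ ≤ 4 / 2 ^ k := by
    have h1 : 8 * (k : ℝ) / 4 ^ k ≤ 2 / 2 ^ k := by
      rw [h4k, div_le_div_iff₀ (by positivity) h2k]; nlinarith [h16, h2k]
    have e : (4 : ℝ) / 2 ^ k = 2 / 2 ^ k + 2 / 2 ^ k := by ring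
    linarith
  have hkε4 : k * ε₀ ≤ 1 / 4 := by
    calc (k : ℝ) * ε₀ ≤ k * (4 / 2 ^ k) := mul_le_mul_of_nonneg_left hε₀4 (Nat.cast_nonneg k)
      _ = 4 * k / 2 ^ k := by ring
      _ ≤ 1 / 4 := by rw [div_le_iff₀ h2k]; linarith
  have hkε : 2 * (k + 1) * ε₀ ≤ 1 := by
    have hk1 : (1 : ℝ) ≤ k := by linarith
    nlinarith [mul_le_mul_of_nonneg_right hk1 hε₀.le]
  have hkε' : 2 * k * ε₀ ≤ 1 := by nlinarith
  have hε₀1 : ε₀ < 1 := by nlinarith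
  have hl0 : 0 < 1 - ε₀ := by linarith
  have hl1 : 0 < 1 - ε₀ / 2 := by linarith
  -- `hgrow`
  have hgrow : ((2 - ε₀ / 2) / (2 - ε₀)) ^ (k - 1) ≤ 3 / 2 := by
    have hx : (2 - ε₀ / 2) / (2 - ε₀) ≤ 1 + ε₀ / 2 := by
      rw [div_le_iff₀ (by linarith)]; nlinarith
    have hx0 : 0 ≤ (2 - ε₀ / 2) / (2 - ε₀) := div_nonneg (by linarith) (by linarith)
    have h1 : ((2 - ε₀ / 2) / (2 - ε₀)) ^ (k - 1) ≤ (1 + ε₀ / 2) ^ (k - 1) :=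
      pow_le_pow_left₀ hx0 hx _
    have hk1le : ((k - 1 : ℕ) : ℝ) ≤ k := by exact_mod_cast Nat.sub_le k 1
    have h3 : ((k - 1 : ℕ) : ℝ) * (ε₀ / 2) ≤ 1 / 8 := by
      have : ((k - 1 : ℕ) : ℝ) * (ε₀ / 2) ≤ k * (ε₀ / 2) :=
        mul_le_mul_of_nonneg_right hk1le (by linarith)
      linarith
    have h2 : (1 + ε₀ / 2) ^ (k - 1) ≤ 1 / (1 - ((k - 1 : ℕ) : ℝ) * (ε₀ / 2)) :=
      one_add_pow_le_one_div (by linarith) (by linarith) (by linarith)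
    have h4 : 1 / (1 - ((k - 1 : ℕ) : ℝ) * (ε₀ / 2)) ≤ 3 / 2 := by
      rw [div_le_iff₀ (by linarith)]; linarith
    linarith
  -- positivity of the `F`'s
  have hne0 : (1 + (1 - ε₀)) ^ k ≠ 1 := ne_of_gt (one_lt_pow₀ (by linarith) (by omega))
  have hne1 : (1 + (1 - ε₀ / 2)) ^ k ≠ 1 := ne_of_gt (one_lt_pow₀ (by linarith) (by omega))
  have hF0 : 0 < pairPoly k (1 - ε₀) (1 / 2) := pairPoly_pos_of_half_le hne0 le_rfl
  have hF1 : 0 < pairPoly k (1 - ε₀ / 2) α := pairPoly_pos_of_half_le hne1 (by linarith)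
  -- AP's normalised first moments `f(1/2,ε₀)`, `f(α,ε₁)` and the numerator `N`
  set f0 : ℝ := pairPoly k (1 - ε₀) (1 / 2) / (2 ^ k * (1 - ε₀) ^ k) with hf0def
  set fα : ℝ := pairPoly k (1 - ε₀ / 2) α / (2 ^ k * (1 - ε₀ / 2) ^ k) with hfαdef
  set Nh : ℝ := α ^ k - 3 * α * k / 2 ^ (k + 1) + (k - 1) / 2 ^ k + 8 * k ^ 2 / 4 ^ k with hNhdef
  have hf0 : 1 - 2 / 2 ^ k - 16 * k / 4 ^ k ≤ f0 := f_half_ge (by omega) hε₀.le hε₀4 hkε'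
  have hdiff : fα - f0 ≤ Nh / (2 ^ k * (1 - ε₀ / 2) ^ k) :=
    fdiff_le (by omega) hε₀ hε₀4 hkε hbal hgrow (by linarith) hα1
  -- `W = fα / f0`
  have hWeq : ((1 - ε₀) / (1 - ε₀ / 2)) ^ k * pairPoly k (1 - ε₀ / 2) α /
      pairPoly k (1 - ε₀) (1 / 2) = fα / f0 := by
    simp only [hfαdef, hf0def]
    rw [div_pow]
    field_simp
  rw [hWeq] at hW ⊢
  -- numeric lower/upper bounds
  have hf0low : (9 : ℝ) / 10 ≤ 1 - 2 / 2 ^ k - 16 * k / 4 ^ k := by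
    have h1 : (2 : ℝ) / 2 ^ k ≤ 2 / 112 := div_le_div_of_nonneg_left (by norm_num) (by norm_num) h112
    have h2 : 16 * (k : ℝ) / 4 ^ k ≤ 1 / 2 ^ k := by
      rw [h4k, div_le_div_iff₀ (by positivity) h2k]; nlinarith [h16, h2k]
    have h3 : (1 : ℝ) / 2 ^ k ≤ 1 / 112 := div_le_div_of_nonneg_left (by norm_num) (by norm_num) h112
    linarith
  have hf0pos : 0 < f0 := by linarith
  have hkk : (k : ℝ) / 2 ^ k ≤ 1 / 16 := by
    rw [div_le_div_iff₀ h2k (by norm_num)]; linarith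
  have hNh : Nh ≤ 11 / 10 := by
    simp only [hNhdef]
    have h1 : α ^ k ≤ 1 := pow_le_one₀ (by linarith) hα1
    have h2 : 0 ≤ 3 * α * k / 2 ^ (k + 1) := by positivity
    have h3 : ((k : ℝ) - 1) / 2 ^ k ≤ 1 / 16 := by
      have : ((k : ℝ) - 1) / 2 ^ k ≤ k / 2 ^ k := div_le_div_of_nonneg_right (by linarith) h2k.le
      linarith
    have h4 : 8 * (k : ℝ) ^ 2 / 4 ^ k ≤ 1 / 32 := by
      have e : 8 * (k : ℝ) ^ 2 / 4 ^ k = 8 * (k / 2 ^ k) ^ 2 := by rw [h4k, div_pow]; field_simp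
      rw [e]
      have : (k / 2 ^ k : ℝ) ^ 2 ≤ (1 / 16) ^ 2 := pow_le_pow_left₀ (by positivity) hkk 2
      linarith
    linarith
  have hbern : 1 - k * (ε₀ / 2) ≤ (1 - ε₀ / 2) ^ k := by
    have h := one_add_mul_le_pow (show (-2 : ℝ) ≤ -(ε₀ / 2) by linarith) k
    have e1 : (1 : ℝ) + -(ε₀ / 2) = 1 - ε₀ / 2 := by ring
    have e2 : (1 : ℝ) + k * -(ε₀ / 2) = 1 - k * (ε₀ / 2) := by ring
    rw [e1, e2] at h; exact h
  have ht78 : (7 : ℝ) / 8 ≤ (1 - ε₀ / 2) ^ k := by linarith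
  have ht1 : (1 - ε₀ / 2) ^ k ≤ 1 := pow_le_one₀ hl1.le (by linarith)
  have htpos : 0 < (1 - ε₀ / 2) ^ k := pow_pos hl1 k
  -- `w = fα/f0 - 1 > 0`
  set w : ℝ := fα / f0 - 1 with hwdef
  have hw0 : 0 < w := by simp only [hwdef]; linarith
  have hweq : w = (fα - f0) / f0 := by simp only [hwdef]; field_simp
  have hdiffpos : 0 < fα - f0 := by
    have : 0 < (fα - f0) / f0 := by rw [← hweq]; exact hw0
    exact (div_pos_iff_of_pos_right hf0pos).mp this
  have hNhpos : 0 < Nh := by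
    have : 0 < Nh / (2 ^ k * (1 - ε₀ / 2) ^ k) := lt_of_lt_of_le hdiffpos hdiff
    exact (div_pos_iff_of_pos_right (by positivity)).mp this
  -- `w ≤ 2/2^k ≤ 1`
  have hU0 : 0 ≤ Nh / (2 ^ k * (1 - ε₀ / 2) ^ k) := by positivity
  have hwle : w ≤ 2 / 2 ^ k := by
    rw [hweq]
    calc (fα - f0) / f0 ≤ (Nh / (2 ^ k * (1 - ε₀ / 2) ^ k)) / (9 / 10) :=
          div_le_div₀ hU0 hdiff (by norm_num) (by linarith)
      _ ≤ ((11 / 10) / (2 ^ k * (7 / 8))) / (9 / 10) := by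
          apply div_le_div_of_nonneg_right _ (by norm_num)
          exact div_le_div₀ (by norm_num) hNh (by positivity)
            (mul_le_mul_of_nonneg_left ht78 h2k.le)
      _ = (88 / 63) / 2 ^ k := by field_simp; ring
      _ ≤ 2 / 2 ^ k := div_le_div_of_nonneg_right (by norm_num) h2k.le
  have hw1 : w ≤ 1 := hwle.trans (by rw [div_le_one h2k]; linarith)
  -- `1/w ≥ (1-ε₁)^k (2^k - 2 - 16k/2^k)/N`
  have hinv : (1 - ε₀ / 2) ^ k * (2 ^ k - 2 - 16 * k / 2 ^ k) / Nh ≤ 1 / w := by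
    have e : (1 - ε₀ / 2) ^ k * (2 ^ k - 2 - 16 * k / 2 ^ k) / Nh =
        (1 - 2 / 2 ^ k - 16 * k / 4 ^ k) / (Nh / (2 ^ k * (1 - ε₀ / 2) ^ k)) := by
      rw [h4k]; field_simp
    rw [e, hweq, one_div_div]
    calc (1 - 2 / 2 ^ k - 16 * k / 4 ^ k) / (Nh / (2 ^ k * (1 - ε₀ / 2) ^ k))
        ≤ (1 - 2 / 2 ^ k - 16 * k / 4 ^ k) / (fα - f0) :=
          div_le_div_of_nonneg_left (by linarith) hdiffpos hdiff
      _ ≤ f0 / (fα - f0) := div_le_div_of_nonneg_right hf0 hdiffpos.le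
  -- the lower bound for `1/w`
  have hlow := inv_w_lower hk hα hα1 htpos ht1
  rw [← hNhdef] at hlow
  -- `r ≤ S (1/w + 1/2 - w/3)`
  have hw3 : w / 3 ≤ 1 / 2 ^ k := by
    have : w / 3 ≤ (2 / 2 ^ k) / 3 := div_le_div_of_nonneg_right hwle (by norm_num)
    have e : (2 / 2 ^ k) / 3 ≤ (1 : ℝ) / 2 ^ k := by
      rw [div_div, div_le_div_iff₀ (by positivity) h2k]; nlinarith [h2k]
    linarith
  have hbr : (1 - ε₀ / 2) ^ k * ((2 ^ k * (k + 1) - 3 * k - 1 / 2) - α * (k * (2 ^ k - 7 / 2))) -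
      ((k + 3) / 2 ^ k + 32 * k ^ 2 * (50 / 81) ^ k + 32 * k * (5 / 9) ^ k) ≤
      1 / w + 1 / 2 - w / 3 := by
    have e : ((k : ℝ) + 3) / 2 ^ k = (k + 2) / 2 ^ k + 1 / 2 ^ k := by ring
    rw [e]
    linarith [hlow, hinv, hw3]
  have hr' : r ≤ S * (1 / w + 1 / 2 - w / 3) := hr.trans (mul_le_mul_of_nonneg_left hbr hS)
  -- conclude
  have h := mul_log_one_add_le_of_le hw0 hw1 hS hr0 hr'
  have e : 1 + w = fα / f0 := by simp only [hwdef]; ring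
  rwa [e] at h

end RandomKSat

end Literature.Computability.Complexity

end
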